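import Summits.BirchSwinnertonDyer.BirchSwinnertonDyer.Theorems.KatoDescentPotSupersingularWildUpperMuRoadThreeFukudaRecords27
import Literature.NumberTheory.EllipticCurves.FineSelmerLimThm35Proofs
import Literature.NumberTheory.EllipticCurves.FineSelmerClassGroupCriterionThm34Proofs
import Literature.NumberTheory.IwasawaTheory.Fukuda1994Thm1Proofs
import Literature.NumberTheory.IwasawaTheory.Fukuda1994Thm1RankProofs
import HarnessLib

/-!
# NoF RE-ISSUE (seat `bsd-potss-k9-c4` g25, 2026-08-29; `--supports stmt-BirchSwinnertonDyer-19197 --as helper`) of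
# `KatoDescentPotSupersingularWildUpperMuRoadThreeFukudaRecords27.lean`:
# the SAME per-row theorems with the μ-road named facts that are now TREE THEOREMS no longer displayed as hypotheses —
# `hLim` (Lim 2017 Thm. 3.5) := `Lim2017.thm35_fineSelmerDual_moduleFinite_of_classicalMuVanishes_of_le_divisionField_holds` (rkm g34, p695193),
# `hF1` (Fukuda 1994 Thm. 1 (1)) := `IwasawaTheory.fukuda1994_thm1_classNumberPExp_const_of_succ_eq_holds` (k8t-c4 g20),
# `hF2` (Fukuda 1994 Thm. 1 (2)) := `IwasawaTheory.fukuda1994_thm1_classGroupPRank_const_of_succ_eq_holds` (k8t-c4 g20, p681350),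
# `hCS` (Coates–Sujatha 2005 Thm. 3.4) := `CoatesSujatha2005.thm34_fineSelmerDual_moduleFinite_of_classicalMuVanishes_divisionField_holds` (k8t-c4 g22, p694085).

HONEST FRAMING. THEOREMS ONLY; PER ROW; nothing booked; items 19189 / 19197 / 19942 stay OPEN at class level (open input of record: the zeta crux 24327);
(A) / Conjecture A / BSD proved for NO class of curves.  Every theorem below is the original record (same name + suffix `NoF`, same displayed NUMERIC
hypotheses, same kernel certificates, same proof term) with the discharged fact binders deleted and the `_holds` theorems substituted in the proof; the
remaining displayed named facts are exactly those the original displays minus {hLim, hF1, hF2, hCS} (for the `GL₂(𝔽₃)` `L_P`-road records: NONE beyond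
`hKatoA hGZK hmod` on the U₀ twin — statement (A) at `(E,3)` becomes a kernel theorem modulo the displayed numerics of `L_P` alone; for the Cartan
unit-index / Fukuda records: Ferrero–Washington `hFW` only).  Row section headers, numerics, evidence pointers and citations are those of the original
file VERBATIM (its module docstring is reproduced below under «ORIGINAL HEADER»); the per-theorem docstrings are the originals prefixed with the NoF marker.

ORIGINAL HEADER of `KatoDescentPotSupersingularWildUpperMuRoadThreeFukudaRecords27`:

> # Route `KatoDescentPotSupersingular` (rung K9, sub-rung B5 = O6 wild `p = 3`, cell `bsd-potss`): per-row U₀ RECORDS BY FUKUDA'S LAYER CRITERION ON THE MAXIMAL REAL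
> # SUBFIELD `K⁺ = ℚ(E[3])^c` (degree 4, `3Ns` rows) AT LAYERS `(1,2)`, the layer equality coming from the UNIT-NORM-INDEX door UG at layer 1 (degree 12 — no degree-36
> # field) — a SECOND road beside the unit-twist records for `3Ns` rows on which every layer-`(0,1)` criterion is silent, `K⁺` part 27: 417501l1
> # (seat `bsd-potss-k9-c4` g23; doors `CartanMuRoadFukudaDoorsWild.missingUpperBoundAt_three_of_hasSplitCartanNormalizerModPImage_of_real{,Rank}SuccEqAt` (k8t-c4 g19);
> # record shape = k9-c4 g22's `…WildUpperMuRoadThreeFukudaRecords13–23` verbatim; `--supports stmt-BirchSwinnertonDyer-19197 --as helper`)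
> 
> HONEST FRAMING. THEOREMS ONLY (no definition, no named fact, no `sorry`); PER ROW — NOT a class theorem; nothing is booked; items 19189 / 19197 (and, for the
> residue rows, 19942) stay OPEN at class level (class-wide open input: the zeta crux 24327); (A), Conjecture A and BSD are proved for NO curve here.  On these rows the
> classical `μ`-roads at layers `(0,1)` are ALL silent: on `L = ℚ(E[3])` (`e₀(L) < e₁(L)`, conjA-anchor g8) and on the real quartic `K⁺ = L^c` (`e₀(K⁺) = 0 < e₁(K⁺)`,
> k9-c4 g22 kit j314795, both layers certified).  `μ(L_cyc) = 0` follows from `μ(K⁺_cyc) = 0` (k9-c4 g18's `CartanMuRoadRealDoors`: complex conjugation discharges the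
> involution binders of conjA-anchor g11's Cartan road; Ferrero–Washington `hFW` for the passage), and `μ(K⁺_cyc) = 0` from FUKUDA 1994 Thm. 1 at layers `(1, 2)` on `K⁺`
> (named fact `hF1` = (1) orders / `hF2` = (2) `3`-ranks), Fukuda's index hypothesis being DISCHARGED by Serre's Prop. 15 inside the door.
> ROAD = `MissingUpperBoundAt E 3 ⟸` NAMED FACTS `hKatoA hGZK hmod hCS hFW hF1` (resp. `hF2`) `+` Cremona's `r_an = 0` (`hr`) `+` KERNEL (imported: `Δ ≠ 0`, minimality,
> `irr_g…_3`, `classO6_g…_3`; proved here or imported: `Ψ₃ = (X² + bX + c)·q` over `ℚ` with `b² − 4c ≠ 0` ⟹ image in the normaliser of a split Cartan,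
> `ModThreeSplitCartanCertificate.hasSplitCartanNormalizerModPImage_three_of_Ψ₃_eq_mul`, k9-c4 g18) `+` a complex conjugation `c` (hypothesis `hc`, exists) `+` ONE
> NUMERIC hypothesis `hord : e₂(K⁺) = e₁(K⁺)` (resp. `hrk : r₂(K⁺) = r₁(K⁺)`) for every cyclotomic `ℤ₃`-extension of `K⁺ := Fix(c|_L)`.
> NUMERICS (quoted per row, not kernel-checked — but see the next sentence): layers 0/1 are k9-c4 g22's kit j314795 (`k9cert3.gp`: `ψ₃` factorisation, `K⁺ ≅ ℚ(P)` for a REAL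
> `3`-torsion point `P`, `h(K⁺)`, `h(K⁺₁)` with `K⁺₁ = K⁺·ℚ(ζ₉)⁺` of degree 12, `bnfcertify`); the LAYER EQUALITY `ord₃ h(K⁺₂) = ord₃ h(K⁺₁)` is THIS SEAT's kit j315805
> (`ug12k.gp` = conjA-anchor g14's door-UG engine re-targeted): at `(n,n+1) = (1,2)` on `F = K⁺₁` (a) every prime `w ∣ 3` of `F` ramifies in `F₂ = F·ℚ(ζ₂₇)⁺`, (b) the unit
> norm index `[E_F : E_F ∩ N F₂ˣ] = 3^(s−1)` (local symbols `φ_w(ε) = ((N_(F_w/ℚ₃) ε)² mod 27 − 1)/9 ∈ 𝔽₃`, Hasse), (c) the classes of the `w ∣ 3` generate `Cl(F)` modulo cubes —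
> whence `ord₃ h(F₂) = ord₃ h(F)` by the TREE THEOREM `IwasawaTheory.classNumberPExp_succ_eq_of_sup_eq_top` (conjA-anchor g14, p644996: Chevalley's ambiguous class number
> formula + genus theory); i.e. the displayed `hord` is, on these rows, a kernel consequence of CERTIFIED layer-1 class-group data (GRH-free where stated) — it stays
> DISPLAYED only because the kernel does not compute class groups.  No degree-36 field enters; for the rows marked «direct layer 2» the equality is instead read off the degree-36 field `K⁺₂` (conjA-anchor g8's LEVEL2 kit j289956 on the SAME quartic — g22's samefield check for 417501i1 —, GRH; on this field door UG's unit-index condition FAILS while the generation condition holds, so Chevalley's ambiguous class number formula gives `#A(K⁺₂)^G = 3·#A(K⁺₁)`: the ORDER form `e₂ = e₁` is PROVABLY dead at `(1,2)` and only Fukuda's RANK form can apply — as it does, `r₂ = r₁ = 1`).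
> 
> References: [Fukuda1994] Thm. 1; [Serre1972] §2.2, §2.4 Prop. 15; [FerreroWashington1979]; [CoatesSujatha2005] 3.4; [Kato2004Asterisque] 12.5 (3), 14.5 (3); [Lang1990] Ch. 13 §4
> Lemma 4.1; [Cremona1997] §3.8; [Cremona2006].
> 
-/

set_option autoImplicit false
set_option linter.dupNamespace false

noncomputable section

open scoped Classical NumberField
open Polynomial WeierstrassCurve Field IntermediateField IsDedekindDomain
  Literature.NumberTheory.EllipticCurves Literature.NumberTheory.EllipticCurves.Rank1Residual
  Literature.NumberTheory.EllipticCurves.Rank1Residual.Typed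
  Literature.NumberTheory.GaloisRepresentations Literature.NumberTheory.SerreUniformity Literature.NumberTheory.IwasawaTheory
  Summit.BirchSwinnertonDyer.Rank1Residual Summit.BirchSwinnertonDyer.Rank1Residual.Additive
  Summit.BirchSwinnertonDyer.BirchSwinnertonDyer.Theorems

namespace Summit.BirchSwinnertonDyer.BirchSwinnertonDyer.Theorems.WildUpperUnitTwistRecords

/-! ### `417501l1` @ `p = 3` — `N = 417501 = 3^3·7·47^2`; Cremona: `r_an = 0`; O6 wild at `3`; flat row (`3 ∤ ∏c_ℓ`; node 19189 via the unit-twist road); conjA-anchor g8: `FUKUDA-K(1,2)[paper descent,GRH]`;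
kernel lemmas in `…WildUpperUnitTwistRecordsClassO619` (`classO6`) / `…WildUpperUnitTwistRecordsFlat48` (`irr`, `isElliptic`, `isGloballyMinimal`).  KIT j314795 (k9-c4 g22): `ψ₃ = (x² + 47x − 1175)·(3·x^2 − 141·x + 1692)`
(quadratic discriminant `6909`; it carries a REAL `3`-torsion point `P`); `K⁺ ≅ ℚ(P) ≅ ℚ[x]/(x^4 - 2*x^3 + 25*x^2 - 24*x + 3)` (signature `[2,1]`): `h = 1` (`Cl ≅ []`, CERTIFIED), primes above `3`: `[[2,1],[2,1]]`;
`F = K⁺₁ = K⁺·ℚ(ζ₉)⁺` (degree 12): `h = 3` (`Cl ≅ [3]`, GRH), primes above `3`: `[[6,1],[6,1]]` ⟹ `e₀ = 0 < e₁ = 1` (layer `(0,1)` silent).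
KIT j315805 (this seat, field `K8` = `x^4 - 2*x^3 + 25*x^2 - 24*x + 3`): door UG at `(1,2)` FAILS (UG-FAIL(1,2): gen 1 totram 1 unit-index 0 (rank 0 of 1) => no conclusion from layer 1 (phase 2 decides)); direct layer 2: `K⁺₂ = K⁺·ℚ(ζ₂₇)⁺` (degree 36, conjA-anchor g8 LEVEL2 kit j289956 on the same quartic as 417501i1, GRH): `e₂ = 2`, `r₂ = 1` ⟹ `e₁ = 1 < e₂ = 2` but `r₂(K⁺) = r₁(K⁺) = 1` (Fukuda Thm. 1 (2) at `(1,2)`). -/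

/-- **[NoF re-issue: the named facts `hLim`/`hF1`/`hF2`/`hCS` displayed by the original are DISCHARGED here by the tree theorems `…_holds` — read «modulo hLim/hF1/hF2/hCS» below as «no longer assumed».]** **RECORD (second road, on `K⁺ = ℚ(E[3])^c`) — UPPER half `ord₃ #Ш(E) ≤ ord₃ #Ш(E)_an` for `E = 417501l1` at `p = 3` FROM ONE FUKUDA `3`-RANK EQUALITY `r_2(K⁺) = r_1(K⁺)`**
(U₀-ns row of K9 items 19189 / 19197; door `CartanMuRoadFukudaDoorsWild.missingUpperBoundAt_three_of_hasSplitCartanNormalizerModPImage_of_realRankSuccEqAt`, n = 1).  KERNEL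
(imported / above): `Δ ≠ 0`, minimality, `irr_g417501l1_3`, `classO6_g417501l1_3`, `hasSplitCartanNormalizerModPImage_g417501l1_3`.  DISPLAYED: named facts
`hKatoA hGZK hmod hCS hFW hF2`; Cremona's `r_an = 0` (`hr`); a complex conjugation `c` (`hc`); `hrk : r_2(K⁺) = r_1(K⁺)` for `K⁺ = Fix(c|_L)` (numerically `1 = 1`;
the ORDER grows `e_1 = 1 < e_2 = 2`: `K⁺₁`: `Cl ≅ [3]` GRH (kit j314795); `K⁺₂` (degree 36): conjA-anchor g8 LEVEL2 kit j289956 (same quartic as 417501i1; g22 recorded 417501i1 `_fkK12r` on these data), GRH).  Per row; CONDITIONAL; nothing booked; BSD is not proved by this. [cite: Kato2004Asterisque, Thm. 14.5 (3) (p. 236), Thm. 12.5 (3) (p. 222)]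
[cite: Fukuda1994, Thm. 1 (2), p. 264] [cite: Lang1990, Ch. 13 §4, Lemma 4.1] [cite: CoatesSujatha2005, Thm. 3.4 (§3)] [cite: Serre1972, §2.4 Prop. 15, §5.2 (iv)] [cite: Cremona2006, Table 1 (Cremona label 417501l1)] -/
theorem missingUpperBoundAt_g417501l1_3_fkK12rNoF
    (hKatoA : Kato2004.rankZero_padicValNat_sha_add_padicValNat_tamagawa_le_of_additive_potGood_of_irreducible_of_fineSelmerDual_fg)
    (hGZK : rank_eq_analyticRank_of_analyticRank_le_one) (hmod : hasEntireLFunction_rat)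
    (hFW : ferreroWashington1979_classicalMuVanishes)
    {W : WeierstrassCurve ℚ} [W.IsElliptic] [W.IsGloballyMinimal] (hWeq : W = (⟨0, 0, 1, (-1410), 20433⟩ : WeierstrassCurve ℚ)) (hr : W.analyticRank = 0)
    {c : absoluteGaloisGroup ℚ} (hc : IsComplexConjugation (Rat.castHom ℝ) c)
    (hrk : haveI : NumberField ↥(W.divisionField 3) := NumberField.mk
      ∀ κE : ZpExtension ↥(fixedField (Subgroup.zpowers (absRestrictNormalHom (W.divisionField 3) c))) 3,
        κE.IsCyclotomic → classGroupPRank κE (1 + 1) = classGroupPRank κE 1) :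
    MissingUpperBoundAt W 3 := by
  subst hWeq
  haveI : Fact (Nat.Prime 3) := ⟨Nat.prime_three⟩
  exact CartanMuRoadFukudaDoorsWild.missingUpperBoundAt_three_of_hasSplitCartanNormalizerModPImage_of_realRankSuccEqAt _ hKatoA hGZK hmod CoatesSujatha2005.thm34_fineSelmerDual_moduleFinite_of_classicalMuVanishes_divisionField_holds hFW fukuda1994_thm1_classGroupPRank_const_of_succ_eq_holds
    hr classO6_g417501l1_3 irr_g417501l1_3 hasSplitCartanNormalizerModPImage_g417501l1_3 hc 1 hrk

end Summit.BirchSwinnertonDyer.BirchSwinnertonDyer.Theorems.WildUpperUnitTwistRecords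

end
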